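import Mathlib
import HarnessLib
import Literature.MathematicalPhysics.QuantumLattice.SSectorNesting
import Summits.HubbardSuperconductivity.HubbardSuperconductivity.Theorems.KLProgrammeH10TwoPointLimitSectorMultiplierFat
import Summits.HubbardSuperconductivity.HubbardSuperconductivity.Theorems.KLProgrammeH10TwoPointLimitFrameTorusBridge

/-!
# Route `KLProgramme` — K3 engine child `KLRegimeEngineV17F2` (stmt-HubbardSuperconductivity-20437), stub (b) `(Hμ)` re-sectorisation:
# ANCESTORS OF OVERLAPPING FINE SECTORS, and the HALF-TURN INDEX MAP (combinatorial bricks of the keyed off-class relative count)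

Cell gate-hubbard-kl, seat p4 (C5a), g12; brick (C) of «KEYED-R1-OFFCLASS».  The keyed relative count of k3c2-p3's jump lemmas ranges over fine
labels `ω″` (scale `J′`) OVERLAPPING the fat multiplier of a coarse label `ω′` (scale `k ≤ J′`), whereas BGM 2003 Lemma 3.1 counts fine sectors
INSIDE prescribed coarse s-sectors (the dyadic ancestor `ω″ / 2^{J′−k}`).  This file supplies the dictionary:

* `sectorWeightCirc_ne_zero_of_le` — angular weight nesting across scales: `ζ_{J′,ω″}(θ) ≠ 0 ⇒ ζ_{k, ω″/2^{J′−k}}(θ) ≠ 0`;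
* `exists_abs_sub_sub_mul_le_one_of_sectorWeightCirc_ne_zero` — two weights of one scale alive at one angle have ADJACENT indices mod `|O_k|`;
* **`exists_ancestor_near_of_overlap`** — if `ω″` overlaps the fat multiplier of `ω′`, the ancestor `ω″/2^{J′−k}` is within `2` of `ω′` modulo
  `|O_k| = sectorCount k` (so at most `5` ancestors per coarse label);
* the half-turn index map `j ↦ j` (charge `+`) / `j ± 2ⁿ` (charge `−`) written as an `if`-term as in `FermiRG/BGM2006AppA3Reduction` (whose copies
  are private): range (`halfTurnIdx_lt`), injectivity (`halfTurnIdx_injOn`), commutation with the ancestor map (`halfTurnIdx_div`);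
* `wrap` arithmetic: the representative `((z % N).toNat)` of an integer class is `< N` and congruent (`toNat_emod_lt`, `dvd_toNat_emod_sub`,
  `eq_toNat_emod_of_dvd`).

Everything is PROVED; no definitions, no named facts.  References: BGM 2006 §2.5 (2.45)–(2.48), §2.7 (2.66)–(2.71) [cite: BenfattoGiulianiMastropietro2006];
BGM 2003 §7.4 [cite: BenfattoGiulianiMastropietro2003].
-/

noncomputable section

namespace Summit.HubbardSuperconductivity.HubbardSuperconductivity.Theorems.PerturbedFermiCurve

set_option linter.dupNamespace false -- summit = problem name (single-conjunct summit), D-0017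

open Classical
open Real Set Finset
open Literature.MathematicalPhysics.QuantumLattice Literature.MathematicalPhysics.QuantumLattice.BandSectorCounting
open Literature.Probability.LatticeModels
open Summit.HubbardSuperconductivity.HubbardSuperconductivity.Theorems.KLProgrammeLegKernels
open Summit.HubbardSuperconductivity.HubbardSuperconductivity.Theorems.TorusFourierL2

/-! ## §1 Angular weights: nesting across scales and adjacency at one scale -/

/-- **Weight nesting across scales**: `ζ_{n′,ω′}(θ) ≠ 0 ⇒ ζ_{n, ω′/2^{n′−n}}(θ) ≠ 0` for `n ≤ n′`. [cite: BenfattoGiulianiMastropietro2006, §2.7 (2.69)] -/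
theorem sectorWeightCirc_ne_zero_of_le {n n' : ℕ} (hn : n ≤ n') {ω' : ℕ} {θ : ℝ}
    (h : sectorWeightCirc n' (ω' : ℤ) θ ≠ 0) : sectorWeightCirc n ((ω' / 2 ^ (n' - n) : ℕ) : ℤ) θ ≠ 0 := by
  obtain ⟨d, rfl⟩ := Nat.exists_eq_add_of_le hn
  rw [Nat.add_sub_cancel_left]
  clear hn
  induction d generalizing ω' with
  | zero => simpa using h
  | succ d ih =>
    -- one step down from scale `n + d + 1` to `n + d`, then the induction hypothesis
    have h1 : sectorWeightCirc (n + d) ((ω' / 2 : ℕ) : ℤ) θ ≠ 0 := by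
      refine sectorWeightCirc_ne_zero_of_child ?_
      rcases Nat.even_or_odd ω' with ⟨r, hr⟩ | ⟨r, hr⟩
      · left
        have e : (2 : ℤ) * ((ω' / 2 : ℕ) : ℤ) = (ω' : ℤ) := by omega
        rw [e]; exact h
      · right
        have e : (2 : ℤ) * ((ω' / 2 : ℕ) : ℤ) + 1 = (ω' : ℤ) := by omega
        rw [e]; exact h
    have h2 := ih h1
    rwa [Nat.div_div_eq_div_mul, ← pow_succ'] at h2

/-- **Adjacency**: if `ζ_{n,a}(θ) ≠ 0` and `ζ_{n,b}(θ) ≠ 0` then `a ≡ b + d (mod |O_n|)` with `|d| ≤ 1` (the supports have width `3w/2`, the centres are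
`w` apart, `|O_n|·w = 2π`). [cite: BenfattoGiulianiMastropietro2006, §2.5 (2.45)] -/
theorem exists_abs_sub_sub_mul_le_one_of_sectorWeightCirc_ne_zero {n : ℕ} {a b : ℤ} {θ : ℝ}
    (ha : sectorWeightCirc n a θ ≠ 0) (hb : sectorWeightCirc n b θ ≠ 0) :
    ∃ t : ℤ, |a - b - t * sectorCount n| ≤ 1 := by
  have hw : 0 < sectorWidth n := sectorWidth_pos n
  have hNw : (sectorCount n : ℝ) * sectorWidth n = 2 * π := sectorCount_mul_sectorWidth n
  obtain ⟨k₁, hk₁⟩ := exists_abs_lt_of_sectorWeightCirc_ne_zero ha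
  obtain ⟨k₂, hk₂⟩ := exists_abs_lt_of_sectorWeightCirc_ne_zero hb
  refine ⟨k₂ - k₁, ?_⟩
  -- `|(a − b)w − 2π(k₂ − k₁)·(−1)…|`: subtract the two localisations
  have h : |((a : ℝ) - b - ((k₂ - k₁ : ℤ) : ℝ) * sectorCount n) * sectorWidth n| < 3 * sectorWidth n / 2 := by
    have e : ((a : ℝ) - b - ((k₂ - k₁ : ℤ) : ℝ) * sectorCount n) * sectorWidth n =
        (θ - ((b : ℝ) + 1 / 2) * sectorWidth n - 2 * π * k₂) - (θ - ((a : ℝ) + 1 / 2) * sectorWidth n - 2 * π * k₁) := by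
      push_cast
      linear_combination (-(k₂ : ℝ) + k₁) * hNw
    rw [e]
    refine (abs_sub _ _).trans_lt ?_
    linarith
  rw [abs_mul, abs_of_pos hw] at h
  have h' : |((a : ℝ) - b - ((k₂ - k₁ : ℤ) : ℝ) * sectorCount n)| < 3 / 2 := by
    by_contra hge
    push Not at hge
    nlinarith
  have hint : |a - b - (k₂ - k₁) * (sectorCount n : ℤ)| < 2 := by
    have : (|((a - b - (k₂ - k₁) * (sectorCount n : ℤ) : ℤ) : ℝ)|) < 2 := by push_cast at h' ⊢; linarith
    exact_mod_cast this
  omega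

/-! ## §2 The ancestor of an overlapping fine label is near the coarse label -/

/-- **Ancestors of overlapping fine labels**: if some momentum carries both `klAnisoFamily … J′ ω″` and the fat multiplier of the coarse label `ω′`
(scale `k ≤ J′`), then the dyadic ancestor `ω″ / 2^{J′−k}` is congruent to `ω′ + D` modulo `sectorCount k` for some `|D| ≤ 2`.
[cite: BenfattoGiulianiMastropietro2006, §2.7 (2.66)–(2.71)] -/
theorem exists_ancestor_near_of_overlap (L M : ℕ) [NeZero L] {e₀ : ℝ} (he : 0 < e₀) {β μ : ℝ} {K : TrigPolyC4v} {k J' : ℕ} (hkJ : k ≤ J')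
    {ω'' : Fin (sectorCount J')} {ω' : Fin (sectorCount k)} {q : FreqMomentum L M}
    (hq : klAnisoFamily L M β μ K e₀ J' ω'' q ≠ 0) (hq' : bgmFatMultiplier L M e₀ β (nambuXiCT L μ K) k ω' q ≠ 0) :
    ∃ D : ℤ, |D| ≤ 2 ∧ (sectorCount k : ℤ) ∣ ((((ω'' : ℕ) / 2 ^ (J' - k) : ℕ) : ℤ) - ((ω' : ℕ) : ℤ) - D) := by
  obtain ⟨-, -, h3⟩ := support_klAnisoFamily L M he β μ K J' ω'' q hq
  have hanc := sectorWeightCirc_ne_zero_of_le hkJ h3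
  obtain ⟨a, ⟨d, hd, hdvd⟩, ha⟩ := exists_fatNbr_of_bgmFatMultiplier_ne_zero e₀ β (nambuXiCT L μ K) k ω' q hq'
  obtain ⟨t, ht⟩ := exists_abs_sub_sub_mul_le_one_of_sectorWeightCirc_ne_zero hanc ha
  obtain ⟨s, hs⟩ := hdvd
  -- `anc = a + d' + tN`, `a = ω′ + d + sN` ⇒ `anc − ω′ − (d + d') = (t + s)N`
  refine ⟨d + (((((ω'' : ℕ) / 2 ^ (J' - k) : ℕ) : ℤ)) - a - t * sectorCount k), ?_, ⟨t + s, ?_⟩⟩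
  · have h1 := abs_le.1 hd; have h2 := abs_le.1 ht
    rw [abs_le]; constructor <;> linarith
  · linear_combination hs

/-! ## §3 The half-turn index map (public copies of the `BGM2006AppA3Reduction` bricks) -/

/-- The half-turn index map `j ↦ j` (`s = true`) / `j ± 2ⁿ` (`s = false`) preserves the range `[0, |O_n|)`.
(adapted from the private `halfTurnIdx_lt` of `FermiRG/BGM2006AppA3Reduction`) [folklore] -/
theorem halfTurnIdx_lt {n : ℕ} (s : Bool) {j : ℕ} (hj : j < sectorCount n) :
    (if s then j else if j < 2 ^ n then j + 2 ^ n else j - 2 ^ n) < sectorCount n := by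
  unfold sectorCount at *
  rw [pow_succ] at *
  split_ifs <;> omega

/-- The half-turn index map is injective on `[0, |O_n|)` for each fixed charge. [folklore] -/
theorem halfTurnIdx_injOn {n : ℕ} (s : Bool) {j j' : ℕ} (hj : j < sectorCount n) (hj' : j' < sectorCount n)
    (h : (if s then j else if j < 2 ^ n then j + 2 ^ n else j - 2 ^ n) =
      (if s then j' else if j' < 2 ^ n then j' + 2 ^ n else j' - 2 ^ n)) : j = j' := by
  unfold sectorCount at *
  rw [pow_succ] at *
  split_ifs at h <;> omega

/-- **The half-turn index map commutes with the ancestor map `ω′ ↦ ω′/2^{n′−n}`** (the antipode of a descendant is a descendant of the antipode).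
[folklore] -/
theorem halfTurnIdx_div {n n' : ℕ} (hn : n ≤ n') (s : Bool) {j' : ℕ} (hj' : j' < sectorCount n') :
    (if s then j' else if j' < 2 ^ n' then j' + 2 ^ n' else j' - 2 ^ n') / 2 ^ (n' - n) =
      (if s then j' / 2 ^ (n' - n) else
        if j' / 2 ^ (n' - n) < 2 ^ n then j' / 2 ^ (n' - n) + 2 ^ n else j' / 2 ^ (n' - n) - 2 ^ n) := by
  obtain ⟨d, rfl⟩ := Nat.exists_eq_add_of_le hn
  rw [Nat.add_sub_cancel_left]
  cases s
  · simp only [Bool.false_eq_true, ↓reduceIte]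
    have hD : 0 < 2 ^ d := by positivity
    have hpow : 2 ^ (n + d) = 2 ^ n * 2 ^ d := pow_add 2 n d
    rw [sectorCount, pow_succ, hpow] at hj'
    by_cases hlt : j' < 2 ^ (n + d)
    · rw [if_pos hlt]
      have h1 : j' / 2 ^ d < 2 ^ n := by
        rw [Nat.div_lt_iff_lt_mul hD]; rwa [hpow] at hlt
      rw [if_pos h1, hpow, Nat.add_mul_div_right _ _ hD]
    · rw [if_neg hlt]
      push Not at hlt
      have h1 : ¬ j' / 2 ^ d < 2 ^ n := by
        rw [not_lt, Nat.le_div_iff_mul_le hD]; rwa [hpow] at hlt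
      rw [if_neg h1, hpow, mul_comm]
      exact Nat.sub_mul_div j' (2 ^ d) (2 ^ n)
  · simp

/-- The half-turn map's congruence class: `hti(s, j) ≡ j + (if s then 0 else 2ⁿ)`-wise — precisely, if `N ∣ (j − j₀ − D)` then
`N ∣ (hti(s,j) − hti(s,j₀′) …)`; we only need: congruent inputs give congruent outputs modulo `|O_n| = 2^{n+1}`. [folklore] -/
theorem halfTurnIdx_congr {n : ℕ} (s : Bool) {j j₀ : ℕ} {D : ℤ} (h : (sectorCount n : ℤ) ∣ ((j : ℤ) - j₀ - D)) :
    (sectorCount n : ℤ) ∣ (((if s then j else if j < 2 ^ n then j + 2 ^ n else j - 2 ^ n : ℕ) : ℤ) -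
      ((if s then j₀ else if j₀ < 2 ^ n then j₀ + 2 ^ n else j₀ - 2 ^ n : ℕ) : ℤ) - D) := by
  unfold sectorCount at *
  obtain ⟨t, ht⟩ := h
  push_cast at ht
  cases s
  · simp only [Bool.false_eq_true, ↓reduceIte]
    split_ifs with h1 h2 h2
    · refine ⟨t, ?_⟩; push_cast; linear_combination ht
    · refine ⟨t + 1, ?_⟩; push_cast [not_lt.1 h2]; linear_combination ht
    · refine ⟨t - 1, ?_⟩; push_cast [not_lt.1 h1]; linear_combination ht
    · refine ⟨t, ?_⟩; push_cast [not_lt.1 h1, not_lt.1 h2]; linear_combination ht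
  · refine ⟨t, ?_⟩; simp only [↓reduceIte]; push_cast; linear_combination ht

/-! ## §4 Representatives of residue classes -/

/-- `(z % N).toNat < N` for `0 < N`. [folklore] -/
theorem toNat_emod_lt {N : ℕ} (hN : 0 < N) (z : ℤ) : (z % (N : ℤ)).toNat < N := by
  have h1 : 0 ≤ z % (N : ℤ) := Int.emod_nonneg _ (by exact_mod_cast hN.ne')
  have h2 : z % (N : ℤ) < N := Int.emod_lt_of_pos _ (by exact_mod_cast hN)
  omega

/-- `N ∣ ((z % N).toNat − z)`. [folklore] -/
theorem dvd_toNat_emod_sub {N : ℕ} (hN : 0 < N) (z : ℤ) : (N : ℤ) ∣ ((((z % (N : ℤ)).toNat : ℕ) : ℤ) - z) := by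
  have h1 : 0 ≤ z % (N : ℤ) := Int.emod_nonneg _ (by exact_mod_cast hN.ne')
  rw [Int.toNat_of_nonneg h1]
  exact ⟨-(z / (N : ℤ)), by rw [Int.emod_def]; ring⟩

/-- **Uniqueness of the representative**: if `a < N` and `N ∣ (a − z)` then `a = (z % N).toNat`. [folklore] -/
theorem eq_toNat_emod_of_dvd {N : ℕ} (hN : 0 < N) {a : ℕ} (ha : a < N) {z : ℤ} (h : (N : ℤ) ∣ ((a : ℤ) - z)) :
    a = (z % (N : ℤ)).toNat := by
  have h1 : 0 ≤ z % (N : ℤ) := Int.emod_nonneg _ (by exact_mod_cast hN.ne')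
  have h2 : z % (N : ℤ) < N := Int.emod_lt_of_pos _ (by exact_mod_cast hN)
  have h3 := dvd_toNat_emod_sub hN z
  have hc : (((z % (N : ℤ)).toNat : ℕ) : ℤ) = z % (N : ℤ) := Int.toNat_of_nonneg h1
  rw [hc] at h3
  -- `N ∣ (a − (z % N))` with both in `[0, N)`
  have h4 : (N : ℤ) ∣ ((a : ℤ) - z % (N : ℤ)) := by
    have := dvd_sub h h3
    have e : (a : ℤ) - z - (z % (N : ℤ) - z) = (a : ℤ) - z % (N : ℤ) := by ring
    rwa [e] at this
  obtain ⟨t, ht⟩ := h4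
  have ht0 : t = 0 := by
    by_contra hne
    rcases lt_or_gt_of_ne hne with hlt | hgt
    · have : t ≤ -1 := by omega
      nlinarith
    · have : 1 ≤ t := by omega
      nlinarith
  subst ht0
  have : (a : ℤ) = (((z % (N : ℤ)).toNat : ℕ) : ℤ) := by rw [hc]; linarith
  exact_mod_cast this

end Summit.HubbardSuperconductivity.HubbardSuperconductivity.Theorems.PerturbedFermiCurve

end
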